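import Mathlib
import HarnessLib
import Summits.CriticalPhenomena.PercolationContinuityZ3.Theorems.PercNearOneGluingNoHeavyLowerTailKnQuestion8AntitheticLevels

/-!
# `NoHeavyLowerTail` (crux stmt-CriticalPhenomena-4575), antithetic vdBHK programme: the HUB CHARGE INEQUALITY (paths)

Support file (seat `prim-ineq-gen-7` gen 26; `--supports stmt-CriticalPhenomena-4575`).  Nothing is asserted about the crux; no `sorry`,
no definitions.  Memo: run/shared/lean/prim/prim-ineq-gen-7/FINDING-PATHS-g26.md §2–§3 (THEOREM H: the per-tree certificate inequality
`(***)` of the tree-block reduction (FINDING-TREEBLOCK-g25.md) holds for EVERY PATH rooted at an end vertex, hence RAA — and ULEX for every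
source — for every unicyclic graph whose pendant trees at cycle vertices are paths, stars or have at most four edges).

CONTEXT.  `(***)` for the path `P_m` is proved by induction on `m` through the HUB LEMMA `val_{P_m}(Y) ≥ val_{P_{m-1}}(Y|F′)`, where
`F′` = the colourings in which the two edges at the root agree (≅ the colouring poset of the contracted path) and the HUB = the colourings
in which they differ (≅ `2^W × {bottom < top}`, `W` = the remaining `m − 2` edges).  After Kleitman mixing in the `W`-direction
(`AntitheticLevel.mixed_ge_pure`, imported) the hub lemma is a sum over `y ⊆ W` of one LOCAL inequality in sixteen bits — four bits for each
of the four up-sets `a, a′, b, b′`: membership of the hub bottom `B_y`, of the hub top `T_y`, of some `F′`-bottom below `T_y` ("`α`"), and of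
the `F′`-top `τ_y` whose successor is `B_y` — subject to `B ⇒ T`, `α ⇒ T`, `B ⇒ τ`.

* `AntitheticHub.hub_local` — the local inequality (a finite check, split into four `decide`s of `2^14` cases each).
* `AntitheticHub.hub_charge` — the HUB CHARGE INEQUALITY: for upper families `S_B ⊆ S_T` (`S = a, a′, b, b′`) of the Boolean lattice
  `2^W` and arbitrary families `S_α ⊆ S_T`, `S_τ ⊇ S_B`,
  `0 ≤ Σ_y [(1_{aB} y − 1_{a′T} yᶜ)(1_{bB} y − 1_{b′T} yᶜ) + (1_{aT} y − 1_{a′B} yᶜ)(1_{bT} y − 1_{b′B} yᶜ)] + Σ_y [c_B y + c_T y + c_new y − c_old y]`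
  with the four certificate indicators of the memo (§2(d)): bottom certificates, top certificates extended by `α`, and new minus old
  certificates of the `F′`-tops.
-/

namespace Summit.CriticalPhenomena.PercolationContinuityZ3.Theorems

open Finset

namespace AntitheticHub

set_option synthInstance.maxSize 100000 in
/-- The local hub inequality with the two `α`-bits of `a, a′` fixed to `true, true` (`2^14` cases, `decide`). -/
private theorem hub_local_tt : ∀ (aB aT aτ a'B a'T a'τ bB bT bα bτ b'B b'T b'α b'τ : Bool),
    (aB = true → aT = true) → (true = true → aT = true) → (aB = true → aτ = true) →
    (a'B = true → a'T = true) → (true = true → a'T = true) → (a'B = true → a'τ = true) →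
    (bB = true → bT = true) → (bα = true → bT = true) → (bB = true → bτ = true) →
    (b'B = true → b'T = true) → (b'α = true → b'T = true) → (b'B = true → b'τ = true) →
    0 ≤ ((if aB then (1:ℤ) else 0) - (if a'T then 1 else 0)) * ((if bB then (1:ℤ) else 0) - (if b'T then 1 else 0))
      + ((if aT then (1:ℤ) else 0) - (if a'B then 1 else 0)) * ((if bT then (1:ℤ) else 0) - (if b'B then 1 else 0))
      + (if ((aT ∧ ¬ a'B ∧ ¬ bB ∧ b'T) ∨ (¬ aB ∧ a'T ∧ bT ∧ ¬ b'B)) then (1:ℤ) else 0)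
      + (if (((aB ∨ true) ∧ (b'B ∨ b'α) ∧ ¬ a'T ∧ ¬ bT) ∨ ((a'B ∨ true) ∧ (bB ∨ bα) ∧ ¬ aT ∧ ¬ b'T)) then (1:ℤ) else 0)
      + (if ((aB ∧ b'B ∧ ¬ a'τ ∧ ¬ bτ) ∨ (a'B ∧ bB ∧ ¬ aτ ∧ ¬ b'τ)) then (1:ℤ) else 0)
      - (if ((true ∧ b'α ∧ ¬ a'τ ∧ ¬ bτ) ∨ (true ∧ bα ∧ ¬ aτ ∧ ¬ b'τ)) then (1:ℤ) else 0) := by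
  decide

set_option synthInstance.maxSize 100000 in
/-- The local hub inequality with the two `α`-bits of `a, a′` fixed to `true, false` (`2^14` cases, `decide`). -/
private theorem hub_local_tf : ∀ (aB aT aτ a'B a'T a'τ bB bT bα bτ b'B b'T b'α b'τ : Bool),
    (aB = true → aT = true) → (true = true → aT = true) → (aB = true → aτ = true) →
    (a'B = true → a'T = true) → (false = true → a'T = true) → (a'B = true → a'τ = true) →
    (bB = true → bT = true) → (bα = true → bT = true) → (bB = true → bτ = true) →
    (b'B = true → b'T = true) → (b'α = true → b'T = true) → (b'B = true → b'τ = true) →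
    0 ≤ ((if aB then (1:ℤ) else 0) - (if a'T then 1 else 0)) * ((if bB then (1:ℤ) else 0) - (if b'T then 1 else 0))
      + ((if aT then (1:ℤ) else 0) - (if a'B then 1 else 0)) * ((if bT then (1:ℤ) else 0) - (if b'B then 1 else 0))
      + (if ((aT ∧ ¬ a'B ∧ ¬ bB ∧ b'T) ∨ (¬ aB ∧ a'T ∧ bT ∧ ¬ b'B)) then (1:ℤ) else 0)
      + (if (((aB ∨ true) ∧ (b'B ∨ b'α) ∧ ¬ a'T ∧ ¬ bT) ∨ ((a'B ∨ false) ∧ (bB ∨ bα) ∧ ¬ aT ∧ ¬ b'T)) then (1:ℤ) else 0)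
      + (if ((aB ∧ b'B ∧ ¬ a'τ ∧ ¬ bτ) ∨ (a'B ∧ bB ∧ ¬ aτ ∧ ¬ b'τ)) then (1:ℤ) else 0)
      - (if ((true ∧ b'α ∧ ¬ a'τ ∧ ¬ bτ) ∨ (false ∧ bα ∧ ¬ aτ ∧ ¬ b'τ)) then (1:ℤ) else 0) := by
  decide

set_option synthInstance.maxSize 100000 in
/-- The local hub inequality with the two `α`-bits of `a, a′` fixed to `false, true` (`2^14` cases, `decide`). -/
private theorem hub_local_ft : ∀ (aB aT aτ a'B a'T a'τ bB bT bα bτ b'B b'T b'α b'τ : Bool),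
    (aB = true → aT = true) → (false = true → aT = true) → (aB = true → aτ = true) →
    (a'B = true → a'T = true) → (true = true → a'T = true) → (a'B = true → a'τ = true) →
    (bB = true → bT = true) → (bα = true → bT = true) → (bB = true → bτ = true) →
    (b'B = true → b'T = true) → (b'α = true → b'T = true) → (b'B = true → b'τ = true) →
    0 ≤ ((if aB then (1:ℤ) else 0) - (if a'T then 1 else 0)) * ((if bB then (1:ℤ) else 0) - (if b'T then 1 else 0))
      + ((if aT then (1:ℤ) else 0) - (if a'B then 1 else 0)) * ((if bT then (1:ℤ) else 0) - (if b'B then 1 else 0))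
      + (if ((aT ∧ ¬ a'B ∧ ¬ bB ∧ b'T) ∨ (¬ aB ∧ a'T ∧ bT ∧ ¬ b'B)) then (1:ℤ) else 0)
      + (if (((aB ∨ false) ∧ (b'B ∨ b'α) ∧ ¬ a'T ∧ ¬ bT) ∨ ((a'B ∨ true) ∧ (bB ∨ bα) ∧ ¬ aT ∧ ¬ b'T)) then (1:ℤ) else 0)
      + (if ((aB ∧ b'B ∧ ¬ a'τ ∧ ¬ bτ) ∨ (a'B ∧ bB ∧ ¬ aτ ∧ ¬ b'τ)) then (1:ℤ) else 0)
      - (if ((false ∧ b'α ∧ ¬ a'τ ∧ ¬ bτ) ∨ (true ∧ bα ∧ ¬ aτ ∧ ¬ b'τ)) then (1:ℤ) else 0) := by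
  decide

set_option synthInstance.maxSize 100000 in
/-- The local hub inequality with the two `α`-bits of `a, a′` fixed to `false, false` (`2^14` cases, `decide`). -/
private theorem hub_local_ff : ∀ (aB aT aτ a'B a'T a'τ bB bT bα bτ b'B b'T b'α b'τ : Bool),
    (aB = true → aT = true) → (false = true → aT = true) → (aB = true → aτ = true) →
    (a'B = true → a'T = true) → (false = true → a'T = true) → (a'B = true → a'τ = true) →
    (bB = true → bT = true) → (bα = true → bT = true) → (bB = true → bτ = true) →
    (b'B = true → b'T = true) → (b'α = true → b'T = true) → (b'B = true → b'τ = true) →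
    0 ≤ ((if aB then (1:ℤ) else 0) - (if a'T then 1 else 0)) * ((if bB then (1:ℤ) else 0) - (if b'T then 1 else 0))
      + ((if aT then (1:ℤ) else 0) - (if a'B then 1 else 0)) * ((if bT then (1:ℤ) else 0) - (if b'B then 1 else 0))
      + (if ((aT ∧ ¬ a'B ∧ ¬ bB ∧ b'T) ∨ (¬ aB ∧ a'T ∧ bT ∧ ¬ b'B)) then (1:ℤ) else 0)
      + (if (((aB ∨ false) ∧ (b'B ∨ b'α) ∧ ¬ a'T ∧ ¬ bT) ∨ ((a'B ∨ false) ∧ (bB ∨ bα) ∧ ¬ aT ∧ ¬ b'T)) then (1:ℤ) else 0)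
      + (if ((aB ∧ b'B ∧ ¬ a'τ ∧ ¬ bτ) ∨ (a'B ∧ bB ∧ ¬ aτ ∧ ¬ b'τ)) then (1:ℤ) else 0)
      - (if ((false ∧ b'α ∧ ¬ a'τ ∧ ¬ bτ) ∨ (false ∧ bα ∧ ¬ aτ ∧ ¬ b'τ)) then (1:ℤ) else 0) := by
  decide

/-- **LOCAL HUB INEQUALITY** (memo §2(d)).  Sixteen bits — for each of the four up-sets `a, a′, b, b′` the membership of the hub
bottom (`B`), the hub top (`T`), of some `F′`-bottom below the hub top (`α`) and of the `F′`-top below which the hub bottom sits (`τ`) —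
constrained by `B ⇒ T`, `α ⇒ T`, `B ⇒ τ`, satisfy: pure bilinear term + bottom certificate + (extended) top certificate + new certificate
of the `F′`-top − old certificate of the `F′`-top ≥ 0.  (4096 admissible configurations; minimum 0.) [this work] -/
theorem hub_local (aB aT aα aτ a'B a'T a'α a'τ bB bT bα bτ b'B b'T b'α b'τ : Bool)
    (h1 : aB = true → aT = true) (h2 : aα = true → aT = true) (h3 : aB = true → aτ = true)
    (h4 : a'B = true → a'T = true) (h5 : a'α = true → a'T = true) (h6 : a'B = true → a'τ = true)
    (h7 : bB = true → bT = true) (h8 : bα = true → bT = true) (h9 : bB = true → bτ = true)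
    (h10 : b'B = true → b'T = true) (h11 : b'α = true → b'T = true) (h12 : b'B = true → b'τ = true) :
    0 ≤ ((if aB then (1:ℤ) else 0) - (if a'T then 1 else 0)) * ((if bB then (1:ℤ) else 0) - (if b'T then 1 else 0))
      + ((if aT then (1:ℤ) else 0) - (if a'B then 1 else 0)) * ((if bT then (1:ℤ) else 0) - (if b'B then 1 else 0))
      + (if ((aT ∧ ¬ a'B ∧ ¬ bB ∧ b'T) ∨ (¬ aB ∧ a'T ∧ bT ∧ ¬ b'B)) then (1:ℤ) else 0)
      + (if (((aB ∨ aα) ∧ (b'B ∨ b'α) ∧ ¬ a'T ∧ ¬ bT) ∨ ((a'B ∨ a'α) ∧ (bB ∨ bα) ∧ ¬ aT ∧ ¬ b'T)) then (1:ℤ) else 0)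
      + (if ((aB ∧ b'B ∧ ¬ a'τ ∧ ¬ bτ) ∨ (a'B ∧ bB ∧ ¬ aτ ∧ ¬ b'τ)) then (1:ℤ) else 0)
      - (if ((aα ∧ b'α ∧ ¬ a'τ ∧ ¬ bτ) ∨ (a'α ∧ bα ∧ ¬ aτ ∧ ¬ b'τ)) then (1:ℤ) else 0) := by
  cases aα <;> cases a'α
  · exact hub_local_ff aB aT aτ a'B a'T a'τ bB bT bα bτ b'B b'T b'α b'τ h1 h2 h3 h4 h5 h6 h7 h8 h9 h10 h11 h12
  · exact hub_local_ft aB aT aτ a'B a'T a'τ bB bT bα bτ b'B b'T b'α b'τ h1 h2 h3 h4 h5 h6 h7 h8 h9 h10 h11 h12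
  · exact hub_local_tf aB aT aτ a'B a'T a'τ bB bT bα bτ b'B b'T b'α b'τ h1 h2 h3 h4 h5 h6 h7 h8 h9 h10 h11 h12
  · exact hub_local_tt aB aT aτ a'B a'T a'τ bB bT bα bτ b'B b'T b'α b'τ h1 h2 h3 h4 h5 h6 h7 h8 h9 h10 h11 h12

variable {α : Type*} [DecidableEq α] [Fintype α]

/-- **HUB CHARGE INEQUALITY** (memo §2).  On the Boolean lattice `2^W` let, for each of `S = a, a′, b, b′`, `S_B ⊆ S_T` be upper families
(traces of the up-set `S` on the hub bottoms / hub tops), `S_α ⊆ S_T` any family (labels `y` such that `S` contains an `F′`-bottom below the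
hub top `T_y`) and `S_τ ⊇ S_B` any family (labels `y` such that `S` contains the `F′`-top `τ_y`).  Then the MIXED bilinear term of the hub
(involution `(y, bottom) ↔ (yᶜ, top)`) plus bottom certificates plus extended top certificates plus new-minus-old certificates of the
`F′`-tops is nonnegative.  Proof: `AntitheticLevel.mixed_ge_pure` twice, then `hub_local` at every `y`.  This is the kernel of the HUB
LEMMA `val_{P_m} ≥ val_{P_{m−1}} ∘ (restriction to F′)`, i.e. of THEOREM H (`(***)` for all paths). [this work] -/
theorem hub_charge (aB aT aα aτ a'B a'T a'α a'τ bB bT bα bτ b'B b'T b'α b'τ : Finset (Finset α))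
    (haB : IsUpperSet (aB : Set (Finset α))) (haT : IsUpperSet (aT : Set (Finset α)))
    (ha'B : IsUpperSet (a'B : Set (Finset α))) (ha'T : IsUpperSet (a'T : Set (Finset α)))
    (hbB : IsUpperSet (bB : Set (Finset α))) (hbT : IsUpperSet (bT : Set (Finset α)))
    (hb'B : IsUpperSet (b'B : Set (Finset α))) (hb'T : IsUpperSet (b'T : Set (Finset α)))
    (h1 : aB ⊆ aT) (h2 : aα ⊆ aT) (h3 : aB ⊆ aτ) (h4 : a'B ⊆ a'T) (h5 : a'α ⊆ a'T) (h6 : a'B ⊆ a'τ)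
    (h7 : bB ⊆ bT) (h8 : bα ⊆ bT) (h9 : bB ⊆ bτ) (h10 : b'B ⊆ b'T) (h11 : b'α ⊆ b'T) (h12 : b'B ⊆ b'τ) :
    0 ≤ (∑ y : Finset α, (((if y ∈ aB then (1:ℤ) else 0) - (if yᶜ ∈ a'T then (1:ℤ) else 0)) * ((if y ∈ bB then (1:ℤ) else 0) - (if yᶜ ∈ b'T then (1:ℤ) else 0))
            + ((if y ∈ aT then (1:ℤ) else 0) - (if yᶜ ∈ a'B then (1:ℤ) else 0)) * ((if y ∈ bT then (1:ℤ) else 0) - (if yᶜ ∈ b'B then (1:ℤ) else 0))))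
        + ∑ y : Finset α,
          ((if ((y ∈ aT ∧ y ∉ a'B ∧ y ∉ bB ∧ y ∈ b'T) ∨ (y ∉ aB ∧ y ∈ a'T ∧ y ∈ bT ∧ y ∉ b'B)) then (1:ℤ) else 0)
          + (if (((y ∈ aB ∨ y ∈ aα) ∧ (y ∈ b'B ∨ y ∈ b'α) ∧ y ∉ a'T ∧ y ∉ bT)
                ∨ ((y ∈ a'B ∨ y ∈ a'α) ∧ (y ∈ bB ∨ y ∈ bα) ∧ y ∉ aT ∧ y ∉ b'T)) then (1:ℤ) else 0)
          + (if ((y ∈ aB ∧ y ∈ b'B ∧ y ∉ a'τ ∧ y ∉ bτ) ∨ (y ∈ a'B ∧ y ∈ bB ∧ y ∉ aτ ∧ y ∉ b'τ)) then (1:ℤ) else 0)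
          - (if ((y ∈ aα ∧ y ∈ b'α ∧ y ∉ a'τ ∧ y ∉ bτ) ∨ (y ∈ a'α ∧ y ∈ bα ∧ y ∉ aτ ∧ y ∉ b'τ)) then (1:ℤ) else 0)) := by
  -- Kleitman mixing in the `W`-direction for the two layers of the hub
  have m1 := AntitheticLevel.mixed_ge_pure aB a'T bB b'T haB ha'T hbB hb'T
  have m2 := AntitheticLevel.mixed_ge_pure aT a'B bT b'B haT ha'B hbT hb'B
  -- the pure sum plus the certificates is nonnegative termwise, by the local inequality
  have hloc : 0 ≤ ∑ y : Finset α, (((if y ∈ aB then (1:ℤ) else 0) - (if y ∈ a'T then (1:ℤ) else 0)) * ((if y ∈ bB then (1:ℤ) else 0) - (if y ∈ b'T then (1:ℤ) else 0))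
      + ((if y ∈ aT then (1:ℤ) else 0) - (if y ∈ a'B then (1:ℤ) else 0)) * ((if y ∈ bT then (1:ℤ) else 0) - (if y ∈ b'B then (1:ℤ) else 0))
      + (if ((y ∈ aT ∧ y ∉ a'B ∧ y ∉ bB ∧ y ∈ b'T) ∨ (y ∉ aB ∧ y ∈ a'T ∧ y ∈ bT ∧ y ∉ b'B)) then (1:ℤ) else 0)
          + (if (((y ∈ aB ∨ y ∈ aα) ∧ (y ∈ b'B ∨ y ∈ b'α) ∧ y ∉ a'T ∧ y ∉ bT)
                ∨ ((y ∈ a'B ∨ y ∈ a'α) ∧ (y ∈ bB ∨ y ∈ bα) ∧ y ∉ aT ∧ y ∉ b'T)) then (1:ℤ) else 0)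
          + (if ((y ∈ aB ∧ y ∈ b'B ∧ y ∉ a'τ ∧ y ∉ bτ) ∨ (y ∈ a'B ∧ y ∈ bB ∧ y ∉ aτ ∧ y ∉ b'τ)) then (1:ℤ) else 0)
          - (if ((y ∈ aα ∧ y ∈ b'α ∧ y ∉ a'τ ∧ y ∉ bτ) ∨ (y ∈ a'α ∧ y ∈ bα ∧ y ∉ aτ ∧ y ∉ b'τ)) then (1:ℤ) else 0)) := by
    refine Finset.sum_nonneg (fun y _ => ?_)
    have key := hub_local (decide (y ∈ aB)) (decide (y ∈ aT)) (decide (y ∈ aα)) (decide (y ∈ aτ))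
      (decide (y ∈ a'B)) (decide (y ∈ a'T)) (decide (y ∈ a'α)) (decide (y ∈ a'τ))
      (decide (y ∈ bB)) (decide (y ∈ bT)) (decide (y ∈ bα)) (decide (y ∈ bτ))
      (decide (y ∈ b'B)) (decide (y ∈ b'T)) (decide (y ∈ b'α)) (decide (y ∈ b'τ))
      (by simpa using fun h => h1 h) (by simpa using fun h => h2 h) (by simpa using fun h => h3 h)
      (by simpa using fun h => h4 h) (by simpa using fun h => h5 h) (by simpa using fun h => h6 h)
      (by simpa using fun h => h7 h) (by simpa using fun h => h8 h) (by simpa using fun h => h9 h)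
      (by simpa using fun h => h10 h) (by simpa using fun h => h11 h) (by simpa using fun h => h12 h)
    simpa only [decide_eq_true_eq, Bool.decide_and, Bool.decide_or, decide_not] using key
  have e1 : ∑ y : Finset α, (((if y ∈ aB then (1:ℤ) else 0) - (if y ∈ a'T then (1:ℤ) else 0)) * ((if y ∈ bB then (1:ℤ) else 0) - (if y ∈ b'T then (1:ℤ) else 0))
      + ((if y ∈ aT then (1:ℤ) else 0) - (if y ∈ a'B then (1:ℤ) else 0)) * ((if y ∈ bT then (1:ℤ) else 0) - (if y ∈ b'B then (1:ℤ) else 0))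
      + (if ((y ∈ aT ∧ y ∉ a'B ∧ y ∉ bB ∧ y ∈ b'T) ∨ (y ∉ aB ∧ y ∈ a'T ∧ y ∈ bT ∧ y ∉ b'B)) then (1:ℤ) else 0)
          + (if (((y ∈ aB ∨ y ∈ aα) ∧ (y ∈ b'B ∨ y ∈ b'α) ∧ y ∉ a'T ∧ y ∉ bT)
                ∨ ((y ∈ a'B ∨ y ∈ a'α) ∧ (y ∈ bB ∨ y ∈ bα) ∧ y ∉ aT ∧ y ∉ b'T)) then (1:ℤ) else 0)
          + (if ((y ∈ aB ∧ y ∈ b'B ∧ y ∉ a'τ ∧ y ∉ bτ) ∨ (y ∈ a'B ∧ y ∈ bB ∧ y ∉ aτ ∧ y ∉ b'τ)) then (1:ℤ) else 0)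
          - (if ((y ∈ aα ∧ y ∈ b'α ∧ y ∉ a'τ ∧ y ∉ bτ) ∨ (y ∈ a'α ∧ y ∈ bα ∧ y ∉ aτ ∧ y ∉ b'τ)) then (1:ℤ) else 0))
    = ∑ y : Finset α, ((if y ∈ aB then (1:ℤ) else 0) - (if y ∈ a'T then (1:ℤ) else 0)) * ((if y ∈ bB then (1:ℤ) else 0) - (if y ∈ b'T then (1:ℤ) else 0))
      + ∑ y : Finset α, ((if y ∈ aT then (1:ℤ) else 0) - (if y ∈ a'B then (1:ℤ) else 0)) * ((if y ∈ bT then (1:ℤ) else 0) - (if y ∈ b'B then (1:ℤ) else 0))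
      + ∑ y : Finset α, ((if ((y ∈ aT ∧ y ∉ a'B ∧ y ∉ bB ∧ y ∈ b'T) ∨ (y ∉ aB ∧ y ∈ a'T ∧ y ∈ bT ∧ y ∉ b'B)) then (1:ℤ) else 0)
          + (if (((y ∈ aB ∨ y ∈ aα) ∧ (y ∈ b'B ∨ y ∈ b'α) ∧ y ∉ a'T ∧ y ∉ bT)
                ∨ ((y ∈ a'B ∨ y ∈ a'α) ∧ (y ∈ bB ∨ y ∈ bα) ∧ y ∉ aT ∧ y ∉ b'T)) then (1:ℤ) else 0)
          + (if ((y ∈ aB ∧ y ∈ b'B ∧ y ∉ a'τ ∧ y ∉ bτ) ∨ (y ∈ a'B ∧ y ∈ bB ∧ y ∉ aτ ∧ y ∉ b'τ)) then (1:ℤ) else 0)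
          - (if ((y ∈ aα ∧ y ∈ b'α ∧ y ∉ a'τ ∧ y ∉ bτ) ∨ (y ∈ a'α ∧ y ∈ bα ∧ y ∉ aτ ∧ y ∉ b'τ)) then (1:ℤ) else 0)) := by
    rw [← Finset.sum_add_distrib, ← Finset.sum_add_distrib]
    exact Finset.sum_congr rfl (fun y _ => by ring)
  have e2 : ∑ y : Finset α, (((if y ∈ aB then (1:ℤ) else 0) - (if yᶜ ∈ a'T then (1:ℤ) else 0)) * ((if y ∈ bB then (1:ℤ) else 0) - (if yᶜ ∈ b'T then (1:ℤ) else 0))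
            + ((if y ∈ aT then (1:ℤ) else 0) - (if yᶜ ∈ a'B then (1:ℤ) else 0)) * ((if y ∈ bT then (1:ℤ) else 0) - (if yᶜ ∈ b'B then (1:ℤ) else 0)))
    = ∑ y : Finset α, ((if y ∈ aB then (1:ℤ) else 0) - (if yᶜ ∈ a'T then (1:ℤ) else 0)) * ((if y ∈ bB then (1:ℤ) else 0) - (if yᶜ ∈ b'T then (1:ℤ) else 0))
      + ∑ y : Finset α, ((if y ∈ aT then (1:ℤ) else 0) - (if yᶜ ∈ a'B then (1:ℤ) else 0)) * ((if y ∈ bT then (1:ℤ) else 0) - (if yᶜ ∈ b'B then (1:ℤ) else 0)) := Finset.sum_add_distrib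
  rw [e1] at hloc
  rw [e2]
  linarith

end AntitheticHub

end Summit.CriticalPhenomena.PercolationContinuityZ3.Theorems
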